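import Literature.NumberTheory.GaloisCohomology.Sakamoto2024KolyvaginFittingIdeal
import HarnessLib

/-!
# S24-DEEP: Sakamoto 2024 Thm. 4.4 (1)(2) for the Kolyvagin datum whose primes are the Chebotarev
# SUB-class cut out at an INDEPENDENT level `3^{m′} ≥ 3^m` through a deeper module `T′` — TYPED INPUT
# of ROUTE-1 (A2 rows), flag `S24-DEEP-PORT@3` (cell `b2b-bsdres`, team n1011, ROUTE-1 §25 item R1-35;
# CLASS-CLOSURE typer of record N11 = seat cc-typer-1, gen 8; typing kit = route planner 1's
# `cells/n1011/route1/R35_sketch.lean` 5ff9e3bc02b3479d, text VERBATIM)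

HONEST FRAMING (cell `b2b-bsdres`, run/shared/lean/b2b/bsd-rank1-residual/, verbatim in every
file): the goal of the cell is to DELETE the COMBINATION-SHAPED residual classes of the
Birch–Swinnerton-Dyer formula for ALL analytic-rank `≤ 1` elliptic curves over `ℚ` — "full BSD
formula for every rank `≤ 1` curve in class `C`" assembled STRICTLY from published theorems — so
that the rank-`≤ 1` remainder becomes exactly the CONSTRUCTION-SHAPED classes, which are TYPED
(missing-input `Prop`s), NOT attempted. This is not "finishing BSD". Team n1011 (N10 / N11, the
additive block X4 ∧ `p = 3`): research route on the CONSTRUCTION-SHAPED class X4; no claim beyond the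
stated classes; nothing is booked; no label and no RESIDUAL-MAP mark is moved by this file. NOTHING
is asserted here: two `Prop`-valued TYPED INPUTS (closed statements, consumed by the route's assembly
F-asm as explicit hypotheses `(h : …_deep)`) and two THEOREMS certifying that each SPECIALISES to the
corresponding landed Literature fact; no `sorry`; no Literature fact is added (fact debt 0).

## What S24-DEEP is, and why it is a PORT and not a citation (ROUTE-1 §24.3, §25.2; lead R5-45 (b),
## R5-46 (f); n1011-lit `LIT-INPUTS-P3.md` §44)

The landed facts `Literature.….Sakamoto2024.kolyvaginSystems_freeRankOne_zmod_three_pow` (p254540)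
and `….kolyvaginSystems_idealOfBasis_eq_fittingIdeal_zmod_three_pow` (p260583) type [S24] Thm. 4.4
(1)(2) for `R = ℤ/3^m`, `K = ℚ`, with the prime set of the Kolyvagin datum PINNED to the module:
`D.primes = frobeniusClassPrimes ρ S τ (3^m)` — Sakamoto's `𝒫` ("`Fr_𝔮` is conjugate to `τ` in
`Gal(H_α(T)/K)`"). On class-A2 rows (`E(ℚ₃)[3] ≠ 0`) Kato's classes for `T = E[3^m]` form a
Kolyvagin system for the PROPAGATED canonical structure only on levels whose primes are DEEP
(`q ≡ 1 ∧ a_q ≡ q + 1 (mod 3^{m+t})`; [MR04] Prop. A.2 "for all sufficiently large `j`"; cell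
convention (B6)). The statement needed there is Thm. 4.4 (1)(2) for the module `T` and the SUB-class
  `𝒫′ = {q ∉ S : Fr_q ~ τ in Gal(ℚ(μ_{3^{m′}}, T′)/ℚ)} ⊆ 𝒫`,  `ker ρ_{T′} ≤ ker ρ_T`, `m′ ≥ m`.

WHAT IS PRINT (read 2026-08-21 from the publisher's OA PDF, `lit` key `paper:url-b54a46bdc6c9`,
file page = printed page − 917). §2, p. 920: "We take a positive integer `α` and put
`H_α := H(μ_{3^α}, (𝒪_K^×)^{3^{−α}})`"; p. 921: "Let `R` be a zero-dimensional Gorenstein local ring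
with finite residue field `𝔽` such that `3^α R = 0` and `char(𝔽) = 3`", (H.2) "There is an element
`τ ∈ G_{H_α}` such that `T/(τ−1)T ≅ R`", (H.3) "The module `H¹(H_α(T)/K, T̄)` vanishes, where
`H_α(T)` is the field corresponds to the kernel of the homomorphism `G_{H_α} → Aut(T)`", and
"`𝒫 := {𝔮 ∉ S(𝓕) | 𝔮 is unramified in H_α(T)/K, Fr_𝔮 is conjugate to τ in Gal(H_α(T)/K)}`".
So `α` is a FREE parameter subject to `3^α R = 0`: for `R = ℤ/3^m` every `α = m′ ≥ m` is admissible,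
and (for `K = ℚ`, `H_α = ℚ(μ_{3^α})`) the CYCLOTOMIC half of deepness — `τ ∈ G_{ℚ(μ_{3^{m′}})}`,
`q ≡ 1 (mod 3^{m′})` — is Sakamoto's own setting at `α := m′`. WHAT IS PORT: the `T`-half — the field
`ℚ(μ_{3^{m′}}, T′) ⊋ H_{m′}(T)` in the Frobenius condition and in (H.3). Thm. 4.4 (p. 926) for
`(𝒫′, 𝒩′)` is not a printed sentence; its proof is Sakamoto's, verbatim, because `𝒫` enters §§4–7
in exactly two ways: (i) RESTRICTIVELY, "for any prime `𝔮 ∈ 𝒫`" — p. 925 L32–35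
"`H¹_ur(K_𝔮, T) ≅ T/(Fr_𝔮 − 1)T ≅ R`", p. 925 L52–53 "`M ≅ M ⊗_ℤ G_d` … by the definition of `𝒫`
and the fact that `3^α R = 0`", Def. 4.1, Lemma 6.1, Lemma 7.4 — all inherited by any subset of `𝒫`
(and `𝒫′ ⊆ 𝒫` because `ker ρ_{T′} ≤ ker ρ_T`); (ii) EXISTENTIALLY, through Lemma 5.2 / Cor. 5.5 only
(Remark 5.4, p. 928: "Lemma 5.2 is only used to prove Corollary 5.5 and Lemma 6.4"), whose proof
(p. 929 L1–33) sets `F := H_α(T)`, uses (H.3) once ("Since we assume that `H¹(F/K, T̄) = 0`, the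
restriction map induces an injection `H¹(K, T̄) ↪ Hom(G_F, T̄)^{G_K}`"), picks `g ∈ G_F` by Lemma 5.1,
takes the primes `𝒮` with Frobenius class of `τg` in `Gal(F₁F₂F₃F₄/K)`, and ends "Since the image of
`τg` in `Gal(H_α/K)` is trivial, we have `(𝒮 ∖ S(𝓕)) ⊂ 𝒫`". Run with `F′ := ℚ(μ_{3^{m′}}, T′) ⊇ F`
in place of `F` — legitimate GIVEN (H.3′) `H¹(F′/ℚ, T̄) = 0` in place of (H.3) — the same paragraph
produces `g ∈ G_{F′}` (still acting trivially on `T`) and primes of `𝒮′ ∖ S ⊂ 𝒫′` (`T′` unramified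
outside `S`). Hence the typed deltas w.r.t. the pinned facts are exactly FOUR (everything else — the
module `T`, `𝓕`, the Poitou–Tate families, the comparison maps at level `3^m`, both conclusions — is
UNCHANGED): (Δ1) binders `(M′, ρ′, m′)` with `m ≤ m′`, `∀ u, ρ′ u = 1 → ρ u = 1` and `ρ′` unramified
outside `S`; (Δ2) (H.2) with `τ ∈ rootsOfUnityFixer ℚ (3^{m′})` [PRINT, `α := m′`]; (Δ3) (H.3′)
stated for `ρ′` and `3^{m′}` [PORT]; (Δ4) `D.primes = frobeniusClassPrimes ρ′ S τ (3^{m′})` [the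
`3^{m′}` PRINT, the `ρ′` PORT]. No lift "`τ′` of `τ`" occurs: `τ : Γ_ℚ` is one automorphism acting on
`T` and on `T′`. The Mazur–Rubin deepness `T′/(τ − 1)T′ ≅ ℤ/3^{m′}` is the CONSUMER's binder (it
makes [MR04] Prop. A.2 applicable), not an input of the structure theorem, and is not typed here.
In Mazur–Rubin's framework such prime sets are native ((H.5) "`𝒫_t ⊂ 𝒫 ⊂ 𝒫_1` for some `t`",
Mem. AMS 799 p. 27; Cor. 4.5.2 (iv)), but their Ch. 4 needs (H.4) = (H.4a) ∨ `p > 4`, and (H.4a)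
`Hom(T̄, T̄^∨(1)) = 0` fails for every elliptic curve at `p = 3` (Weil pairing) — which is why
Sakamoto's `p = 3` theorem, with its pinned `𝒫`, is the source, and why the sub-class costs a port.

PLACEMENT (route planner 1's recommendation R1-39, typer's filing): a PORT is not a cited published
statement, so it is NOT a `Literature/` fact (hub rule: a Literature `def … : Prop` cites a source
that PROVES it); like `KatoKuriharaDictionaryThree` and `X6.IMCDivOnClassicalData` it lives
Summits-side as a typed hypothesis of the route's assembly, fact debt 0; the two `…_of_deep` theorems
below are its conservativity certificate (`T′ := T`, `m′ := m` returns p254540 / p260583 literally).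
DISCHARGE OF (H.3′) ON N11 ROWS (ROUTE-1 R1-40): for `T = E[3^{k+1}]`, `T′ = E[3^{k′+1}]`,
`T̄ = E[3]` the binder (Δ3) is LITERALLY the statement of the landed theorem
`GaloisImage.hH3_of_hasSurjectiveModNGaloisRep W 3 k′ …` / `GaloisImage.hH3_three_of_towerSurj W k′
htower` (`InflationRestrictionSakamotoH3.lean`, p04) at `k′ = m′ − 1` — the same proof that
discharges (H.3) at level `m` discharges (H.3′) at level `m′`; no new kernel work.

References: R. Sakamoto, *The theory of Kolyvagin systems for `p = 3`*, J. Théor. Nombres Bordeaux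
**36** (2024) 919–946: §2 (pp. 920–921), §4 p. 925, Def. 4.1–Thm. 4.4 (p. 926), Lemma 5.2, Remarks
5.3–5.4 (p. 928), proof and Cor. 5.5 (p. 929), Lemma 6.4, Lemma 7.4, Props. 7.6–7.7;
B. Mazur, K. Rubin, *Kolyvagin systems*, Mem. AMS **799** (2004): §3.5 (H.4)–(H.5) (p. 27),
Cor. 4.5.2 (iv) (p. 48), Prop. A.2 (pp. 79–80); the docstrings of the two landed facts (not repeated).
-/

noncomputable section

open scoped Classical NumberField ContRepresentation
open Field NumberField IsDedekindDomain
open Literature.NumberTheory.GaloisRepresentations Literature.NumberTheory.GaloisRepresentations.DiscreteGaloisModule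
  Literature.NumberTheory.GaloisCohomology

namespace Summit.BirchSwinnertonDyer.Rank1Residual.GaloisImage.S24Deep

/-- **S24-DEEP (1)** — [S24] Thm. 4.4 (1) for `R = ℤ/3^m`, `K = ℚ`, and the Kolyvagin datum whose
primes are the Chebotarev SUB-class cut out at an independent level `3^{m′} ≥ 3^m` through an
auxiliary module `T′` with `ker ρ_{T′} ≤ ker ρ_T` (think `T = E[3^m]`, `T′ = E[3^{m′}]`): Frobenius
conjugate to `τ` in `Gal(ℚ(μ_{3^{m′}}, T′)/ℚ)`. Binders and conclusion = the landed pinned fact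
`Sakamoto2024.kolyvaginSystems_freeRankOne_zmod_three_pow` VERBATIM except the four deltas (Δ1)–(Δ4)
of the module docstring. Cyclotomic half (`3^{m′}` in (H.2) and in the class) = PRINT with Sakamoto's
`α := m′`; `T`-half (`ρ′` in the class and in (H.3′)) = PORT of Sakamoto's proof, flag
`S24-DEEP-PORT@3`. TYPED INPUT of ROUTE-1's assembly on A2 rows; nothing asserted; the case
`T′ = T`, `m′ = m` is the landed fact (`freeRankOne_of_deep`).
[cite: Sakamoto2024, Thm. 4.4 (1) (p. 926); §2 (pp. 920–921); Lemma 5.2, Rem. 5.4, Cor. 5.5 (pp. 928–929) — PORT, not a printed sentence]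
[cite: MazurRubin2004, §3.5 (H.5) (p. 27); Cor. 4.5.2 (iv) (p. 48); Prop. A.2 (pp. 79–80) — context] -/
def kolyvaginSystems_freeRankOne_zmod_three_pow_deep : Prop :=
  ∀ (M : Type) [AddCommGroup M] [TopologicalSpace M] [DiscreteTopology M] [Finite M]
    (Mbar : Type) [AddCommGroup Mbar] [TopologicalSpace Mbar] [DiscreteTopology Mbar] [Finite Mbar]
    (m : ℕ) [NeZero m] [Module (ZMod (3 ^ m)) M] [Module.Free (ZMod (3 ^ m)) M]
    [Module.Finite (ZMod (3 ^ m)) M]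
    -- (Δ1) the auxiliary deeper module `T′` and its level `m′`
    (M' : Type) [AddCommGroup M'] [TopologicalSpace M'] [DiscreteTopology M'] [Finite M'] (m' : ℕ)
    (ρ : DiscreteGaloisModule ℚ M) (ρ' : DiscreteGaloisModule ℚ M') (ρbar : DiscreteGaloisModule ℚ Mbar)
    (red : ρ.toContRepresentation →ⁱL ρbar.toContRepresentation)
    (incl : ρbar.toContRepresentation →ⁱL ρ.toContRepresentation)
    (τ : absoluteGaloisGroup ℚ)
    (θ : ρbar.toContRepresentation →ⁱL (ρbar.tateDual 3).toContRepresentation)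
    (inv : LocalInvariants ℚ 3)
    (S : Finset (Place ℚ)) (𝓕 : SelmerStructure ρ) (D : KolyvaginDatum ρ)
    (η : (q : HeightOneSpectrum (𝓞 ℚ)) → (ZMod (Ideal.absNorm q.asIdeal))ˣ),
    -- (Δ1) `m ≤ m′`, `ℚ(T) ⊆ ℚ(T′)` (so that `Fr_q ~ τ` on `T′` gives `Fr_q ~ τ` on `T`)
    m ≤ m' →
    (∀ u : absoluteGaloisGroup ℚ, ρ' u = 1 → ρ u = 1) →
    -- the residual pair is `T ↠ T/3T`, `T/3T ↪ T` with `incl ∘ red = 3^{m-1}`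
    Function.Surjective red →
    (∀ x : M, red x = 0 ↔ ∃ y : M, x = (3 : ℤ) • y) →
    (∀ x : M, incl (red x) = ((3 : ℤ) ^ (m - 1)) • x) →
    -- (H.1)
    (∀ H : AddSubgroup Mbar, (∀ (σ : absoluteGaloisGroup ℚ) (x : Mbar), x ∈ H → ρbar σ x ∈ H) →
      H = ⊥ ∨ H = ⊤) →
    -- (H.2): (Δ2) the cyclotomic half at level `3^{m′}` [PRINT, `α := m′`]; the `T`-half on `T`
    τ ∈ rootsOfUnityFixer ℚ (3 ^ m') → Nonempty (cokerSubOne ρ τ ≃+ ZMod (3 ^ m)) →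
    -- (Δ3) (H.3′) at `F′ = ℚ(μ_{3^{m′}}, T′)` [PORT]; implies (H.3) by inflation
    (∀ f : contOneCocycles ρbar.toTopRep,
      (∀ u : absoluteGaloisGroup ℚ, ρ' u = 1 → u ∈ rootsOfUnityFixer ℚ (3 ^ m') → f.1 u = 0) →
        oneCocycleClass ρbar.toTopRep f = 0) →
    -- (H.SD)
    Function.Bijective θ →
    -- the local duality family (Poitou–Tate)
    inv.IsPerfect → inv.SumLocalTermEqZero → inv.UnramifiedOrthogonal → inv.SelmerComplement →
    -- `S(𝓕) = S ⊇ {∞, 3} ∪ S_ram(T) ∪ S_ram(T′)` ((Δ1): the `T′` clause), `H¹_ur` outside `S`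
    (∀ w : InfinitePlace ℚ, (Sum.inl w : Place ℚ) ∈ S) →
    (∀ v : HeightOneSpectrum (𝓞 ℚ), (Sum.inr v : Place ℚ) ∉ S →
      ((3 : ℕ) : 𝓞 ℚ) ∉ v.asIdeal ∧ GaloisRep.IsUnramifiedAt v ρ) →
    (∀ v : HeightOneSpectrum (𝓞 ℚ), (Sum.inr v : Place ℚ) ∉ S → GaloisRep.IsUnramifiedAt v ρ') →
    𝓕.IsUnramifiedOutside S →
    -- the hypotheses of Thm. 4.4 on `𝓕`
    𝓕.IsCartesian red incl S →
    LocalInvariants.HasCoreRank inv (𝓕.induced red) 3 1 →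
    inv.IsResiduallyCoisotropic (𝓕.induced red) θ S →
    -- the Kolyvagin datum: (Δ4) the DEEP sub-class; the transverse conditions; THE comparison maps
    D.primes = frobeniusClassPrimes ρ' {v | (Sum.inr v : Place ℚ) ∈ S} τ (3 ^ m') →
    D.transverse = cyclotomicTransverse ρ →
    D.HasCanonicalComparison (3 ^ m) η →
    -- conclusion (1), unchanged
    KolyvaginSystem.IsFreeRankOneZMod (D.kolyvaginSystems 𝓕) (3 ^ m) ∧
      ∀ (d : Finset (HeightOneSpectrum (𝓞 ℚ))) (hd : D.IsLevel d),
        LocalInvariants.lambdaStar inv ((D.atLevel 𝓕 d).induced red) 3 = 0 →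
        Function.Bijective fun κ : D.kolyvaginSystems 𝓕 =>
          (⟨κ.1 d, ((KolyvaginDatum.mem_kolyvaginSystems_iff D 𝓕 κ.1).mp κ.2).mem_selmerGroup d hd⟩ :
            (D.atLevel 𝓕 d).selmerGroup)

/-- **S24-DEEP (2)** — the R1-22 ORDER form (p260583's unfolding of [S24] Thm. 4.4 (2) for
`R = ℤ/3^m`: `ord(κ_d) · #H¹_{𝓕(d)^*}(ℚ, T^∨(1)) = 3^m` if `#H¹_{𝓕(d)^*} ∣ 3^m`, and `κ_d = 0` if
`3^m ∣ #H¹_{𝓕(d)^*}`, for a basis `κ` of `KS₁` and a second Poitou–Tate family `inv'` at the full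
level `3^m`) for the same deep sub-class datum; binders = p260583 VERBATIM except (Δ1)–(Δ4); PORT,
flag `S24-DEEP-PORT@3`; TYPED INPUT, nothing asserted; `T′ = T`, `m′ = m` is p260583
(`idealOfBasis_of_deep`).
[cite: Sakamoto2024, Def. 4.2, Rem. 4.3, Thm. 4.4 (2) (p. 926), Prop. 7.7 (p. 936); §2 (pp. 920–921); Lemma 5.2, Cor. 5.5 — PORT, not a printed sentence]
[cite: MazurRubin2004, §3.5 (H.5) (p. 27); Cor. 4.5.2 (iv) (p. 48) — context] -/
def kolyvaginSystems_idealOfBasis_eq_fittingIdeal_zmod_three_pow_deep : Prop :=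
  ∀ (M : Type) [AddCommGroup M] [TopologicalSpace M] [DiscreteTopology M] [Finite M]
    (Mbar : Type) [AddCommGroup Mbar] [TopologicalSpace Mbar] [DiscreteTopology Mbar] [Finite Mbar]
    (m : ℕ) [NeZero m] [Module (ZMod (3 ^ m)) M] [Module.Free (ZMod (3 ^ m)) M]
    [Module.Finite (ZMod (3 ^ m)) M]
    (M' : Type) [AddCommGroup M'] [TopologicalSpace M'] [DiscreteTopology M'] [Finite M'] (m' : ℕ)
    (ρ : DiscreteGaloisModule ℚ M) (ρ' : DiscreteGaloisModule ℚ M') (ρbar : DiscreteGaloisModule ℚ Mbar)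
    (red : ρ.toContRepresentation →ⁱL ρbar.toContRepresentation)
    (incl : ρbar.toContRepresentation →ⁱL ρ.toContRepresentation)
    (τ : absoluteGaloisGroup ℚ)
    (θ : ρbar.toContRepresentation →ⁱL (ρbar.tateDual 3).toContRepresentation)
    (inv : LocalInvariants ℚ 3)
    (S : Finset (Place ℚ)) (𝓕 : SelmerStructure ρ) (D : KolyvaginDatum ρ)
    (η : (q : HeightOneSpectrum (𝓞 ℚ)) → (ZMod (Ideal.absNorm q.asIdeal))ˣ),
    m ≤ m' →
    (∀ u : absoluteGaloisGroup ℚ, ρ' u = 1 → ρ u = 1) →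
    Function.Surjective red →
    (∀ x : M, red x = 0 ↔ ∃ y : M, x = (3 : ℤ) • y) →
    (∀ x : M, incl (red x) = ((3 : ℤ) ^ (m - 1)) • x) →
    (∀ H : AddSubgroup Mbar, (∀ (σ : absoluteGaloisGroup ℚ) (x : Mbar), x ∈ H → ρbar σ x ∈ H) →
      H = ⊥ ∨ H = ⊤) →
    τ ∈ rootsOfUnityFixer ℚ (3 ^ m') → Nonempty (cokerSubOne ρ τ ≃+ ZMod (3 ^ m)) →
    (∀ f : contOneCocycles ρbar.toTopRep,
      (∀ u : absoluteGaloisGroup ℚ, ρ' u = 1 → u ∈ rootsOfUnityFixer ℚ (3 ^ m') → f.1 u = 0) →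
        oneCocycleClass ρbar.toTopRep f = 0) →
    Function.Bijective θ →
    inv.IsPerfect → inv.SumLocalTermEqZero → inv.UnramifiedOrthogonal → inv.SelmerComplement →
    (∀ w : InfinitePlace ℚ, (Sum.inl w : Place ℚ) ∈ S) →
    (∀ v : HeightOneSpectrum (𝓞 ℚ), (Sum.inr v : Place ℚ) ∉ S →
      ((3 : ℕ) : 𝓞 ℚ) ∉ v.asIdeal ∧ GaloisRep.IsUnramifiedAt v ρ) →
    (∀ v : HeightOneSpectrum (𝓞 ℚ), (Sum.inr v : Place ℚ) ∉ S → GaloisRep.IsUnramifiedAt v ρ') →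
    𝓕.IsUnramifiedOutside S →
    𝓕.IsCartesian red incl S →
    LocalInvariants.HasCoreRank inv (𝓕.induced red) 3 1 →
    inv.IsResiduallyCoisotropic (𝓕.induced red) θ S →
    D.primes = frobeniusClassPrimes ρ' {v | (Sum.inr v : Place ℚ) ∈ S} τ (3 ^ m') →
    D.transverse = cyclotomicTransverse ρ →
    D.HasCanonicalComparison (3 ^ m) η →
    ∀ inv' : LocalInvariants ℚ (3 ^ m),
      inv'.IsPerfect → inv'.SumLocalTermEqZero → inv'.UnramifiedOrthogonal → inv'.SelmerComplement →
    ∀ κ : D.kolyvaginSystems 𝓕, AddSubgroup.zmultiples κ = ⊤ →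
      ∀ d : Finset (HeightOneSpectrum (𝓞 ℚ)), D.IsLevel d →
        (Nat.card (inv'.dualSelmerStructure ρ (D.atLevel 𝓕 d)).selmerGroup ∣ 3 ^ m →
          addOrderOf (κ.1 d) * Nat.card (inv'.dualSelmerStructure ρ (D.atLevel 𝓕 d)).selmerGroup =
            3 ^ m) ∧
        (3 ^ m ∣ Nat.card (inv'.dualSelmerStructure ρ (D.atLevel 𝓕 d)).selmerGroup → κ.1 d = 0)

/-- **Conservativity certificate 1.** The deep statement (1) SPECIALISES (`T′ := T`, `ρ′ := ρ`,
`m′ := m`) to the landed pinned fact `Sakamoto2024.kolyvaginSystems_freeRankOne_zmod_three_pow`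
(p254540): the generalisation asks nothing new on the printed case. [folklore] -/
theorem freeRankOne_of_deep (h : kolyvaginSystems_freeRankOne_zmod_three_pow_deep) :
    Sakamoto2024.kolyvaginSystems_freeRankOne_zmod_three_pow := by
  intro M _ _ _ _ Mbar _ _ _ _ m _ _ _ _ ρ ρbar red incl τ θ inv S 𝓕 D η hred hker hincl hH1 hτ hH2
    hH3 hθ hperf hsum hur hcompl hS hSout h𝓕S hcart hcore hcoiso hP hT hcan
  exact h M Mbar m M m ρ ρ ρbar red incl τ θ inv S 𝓕 D η le_rfl (fun _ hu => hu) hred hker hincl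
    hH1 hτ hH2 hH3 hθ hperf hsum hur hcompl hS hSout (fun v hv => (hSout v hv).2) h𝓕S hcart hcore
    hcoiso hP hT hcan

/-- **Conservativity certificate 2.** The deep statement (2) SPECIALISES (`T′ := T`, `ρ′ := ρ`,
`m′ := m`) to the landed R1-22 fact
`Sakamoto2024.kolyvaginSystems_idealOfBasis_eq_fittingIdeal_zmod_three_pow` (p260583). [folklore] -/
theorem idealOfBasis_of_deep (h : kolyvaginSystems_idealOfBasis_eq_fittingIdeal_zmod_three_pow_deep) :
    Sakamoto2024.kolyvaginSystems_idealOfBasis_eq_fittingIdeal_zmod_three_pow := by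
  intro M _ _ _ _ Mbar _ _ _ _ m _ _ _ _ ρ ρbar red incl τ θ inv S 𝓕 D η hred hker hincl hH1 hτ hH2
    hH3 hθ hperf hsum hur hcompl hS hSout h𝓕S hcart hcore hcoiso hP hT hcan
  exact h M Mbar m M m ρ ρ ρbar red incl τ θ inv S 𝓕 D η le_rfl (fun _ hu => hu) hred hker hincl
    hH1 hτ hH2 hH3 hθ hperf hsum hur hcompl hS hSout (fun v hv => (hSout v hv).2) h𝓕S hcart hcore
    hcoiso hP hT hcan

end Summit.BirchSwinnertonDyer.Rank1Residual.GaloisImage.S24Deep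

end
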